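import Literature.Probability.Percolation.TriChordSides2
import HarnessLib

/-!
# Claim 10 of Bollobás–Riordan in the frame of `A₀`: the side of `w`, `x₃` off the path and closed

Topic `Literature/Probability/Percolation`; family `crit-perc`. First half of the proof of the
weak form of **Claim 10** (Bollobás–Riordan, *Percolation* (2006), Ch. 7, pp. 177–179), for a
3-marked discrete domain in the frame where the target arc is `A₀`: the separating open path
`P` (as the list `Q` of its sites, from a site `u ∈ A₁` at position `nᵤ` to `v ∈ A₂` at `nᵥ`)
and the face `w` with vertices `x₃ = x_r, x₁ = x_{r+1}, x₂ = x_{r+2}`, `z` its neighbour across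
`x₁x₂`, under the standing hypotheses `Sep(Q, z)` and "no admissible path separates `w`".
Theorems only:

* `isTriLoop_chordLoop_frame` — the chord loop `C₂(Q)` is a lattice loop;
* `sym2_mem_bondSet_of_separates` — **Step 1**: `Q` uses the bond `x₁x₂` (p. 177: "`C` winds
  around `z` but not around `w`, therefore `C` must use the edge `x₁x₂`");
* `faceLabel_chordLoop_w` — `w` lies to the left of `C₂(Q)` (it is joined off `Q` to `A₀`),
  hence `Q` traverses `x₁ → x₂` and `z` lies to the right (p. 177, orientation);
* `faceLabel_loop_eq_zero_of_shortcut` — **the shortcut lemma**: modifying `Q` on a segment into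
  another admissible path, the segment closed up along the new piece is a loop with `w` outside
  (two-chain invariance with `C₂(Q)`);
* `faceVertex_not_mem_support`, `faceVertex_not_mem_of_not_mem` — **Step 3**: `x₃` is off the
  path and closed ("otherwise the open path `P₁x₃P₂` separates `w`", p. 177; by the shortcut
  lemma and the triangle `x₁x₂x₃`, of label `1` at `w`).

## References

* B. Bollobás, O. Riordan, *Percolation*, Cambridge University Press (2006), Ch. 7, Claim 10
  pp. 177–179.

## Mathlib / tree

Tree: `TriFaceLabel.lean`, `TriChordSides.lean`, `TriChordSides2.lean`; `Separates`,
`TriMarkedDomain.stretch/arc` (`TriDiscreteDomain.lean`).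
-/

namespace Literature.Probability.Percolation

open LatticeModels Finset
open RemovableAt (hexFaceVertices_leftFaceDir)

/-! ## Claim 10 in the frame of `A₀`: the standing hypotheses -/

section Claim10Frame

variable (D : TriMarkedDomain 3) {ω : Set (Site 2)} {w : HexVertex} {r : Fin 3}
  {Q : List (Site 2)} {nu nv : ℕ}

namespace TriMarkedDomain

/-- **The chord loop of an admissible path is a lattice loop** (frame of `A₀`: `Q` from the tail
of position `nᵤ ∈ [pos 1, pos 2)` to the tail of position `nᵥ ∈ [pos 2, #∂)`, at least two sites;
the heads over `[nᵥ, nᵤ + #∂]` do not repeat because the heads change before the mark `v₂`,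
inside `(nᵤ, nᵥ)`). [folklore] -/
theorem isTriLoop_chordLoop_frame (hQne : Q ≠ []) (hQnd : Q.Nodup) (hQch : List.IsChain triGraph.Adj Q)
    (hQG : ∀ s ∈ Q, s ∈ D.verts) (hQ2 : 2 ≤ Q.length) (hnu2 : nu < D.pos 2) (hnv2 : D.pos 2 ≤ nv)
    (hnvL : nv < #(triBdryDarts D.verts))
    (hQhead : Q.head hQne = (triBdryIter D.verts D.base nu).1)
    (hQlast : Q.getLast hQne = (triBdryIter D.verts D.base nv).1) :
    IsTriLoop (D.chordLoop Q nv (nu + #(triBdryDarts D.verts) - nv)) := by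
  set L := #(triBdryDarts D.verts) with hL
  have hlen : nv + (nu + L - nv) = nu + L := by omega
  refine D.isTriLoop_chordLoop hQne hQnd hQch hQG hQ2 hQlast (by rw [hlen, D.iter_add_card]; exact hQhead) ?_
  -- heads change at the step into the mark `v₂`, one period later: position `pos 2 + L - 1`
  have hc := D.bdryHead_markPos_pred_ne 2
  have h3 := D.three_le_card 0
  refine D.headsList_nodup (N := nu + L - nv) (c := D.pos 2 + (L - 1)) (by omega) (by omega) hc le_rfl

/-- The bonds of the chord loop inside `G` are bonds of the path. [folklore] -/
theorem sym2_mem_bondSet_of_mem_cycDarts_chordLoop (hQne : Q ≠ []) {len : ℕ} {d : Site 2 × Site 2}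
    (hd : d ∈ cycDarts (D.chordLoop Q nv len)) (h1 : d.1 ∈ D.verts) (h2 : d.2 ∈ D.verts) :
    s(d.1, d.2) ∈ {e : Sym2 (Site 2) | ∃ d' ∈ pathDarts Q, e = s(d'.1, d'.2)} :=
  ⟨d, D.mem_pathDarts_of_mem_cycDarts_chordLoop hQne hd h1 h2, rfl⟩

/-- **Labels of the chord loop are constant along dual paths of `G` not crossing the path.** [folklore] -/
theorem faceLabel_chordLoop_eq_of_reflTransGen (hQne : Q ≠ []) {len : ℕ} (hC : IsTriLoop (D.chordLoop Q nv len))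
    {F F' : HexVertex}
    (h : Relation.ReflTransGen (DualStep D.verts {e : Sym2 (Site 2) | ∃ d ∈ pathDarts Q, e = s(d.1, d.2)}) F F') :
    faceLabel (cycDarts (D.chordLoop Q nv len)) F = faceLabel (cycDarts (D.chordLoop Q nv len)) F' :=
  faceLabel_eq_of_reflTransGen_dualStep hC.adj
    (fun _ hd h1 h2 => D.sym2_mem_bondSet_of_mem_cycDarts_chordLoop hQne hd h1 h2) h

/-- **Step 1: the path uses the bond `x₁x₂`** ("`C` winds around `z` but not around `w`.
Therefore, `C` must use the edge `x₁x₂`", p. 177): otherwise the dual step from `z` to `w`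
across it, followed by a dual path from `w` to `A₀` off the path (which exists as the path does
not separate `w`), would join `z` to `A₀` off the path. [cite: BollobasRiordan2006, Ch. 7 §7.2.2 p. 177] -/
theorem sym2_mem_bondSet_of_separates (hw : hexFaceVertices w ⊆ D.verts)
    (hsep : Separates D.verts {e : Sym2 (Site 2) | ∃ d ∈ pathDarts Q, e = s(d.1, d.2)} (oppFace w r) (D.stretch 0))
    (hns : ¬ Separates D.verts {e : Sym2 (Site 2) | ∃ d ∈ pathDarts Q, e = s(d.1, d.2)} w (D.stretch 0)) :
    s(faceVertex w (r + 1), faceVertex w (r + 2)) ∈ {e : Sym2 (Site 2) | ∃ d ∈ pathDarts Q, e = s(d.1, d.2)} := by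
  by_contra hab
  have hstep : DualStep D.verts {e : Sym2 (Site 2) | ∃ d ∈ pathDarts Q, e = s(d.1, d.2)} (oppFace w r) w := by
    refine ⟨(hexGraph_adj_oppFace w r).symm, ?_, ?_⟩
    · rw [faceEdge_comm, faceEdge_oppFace]
      intro y hy
      simp only [Finset.mem_insert, Finset.mem_singleton] at hy
      rcases hy with rfl | rfl <;> exact hw (faceVertex_mem _ _)
    · intro x y hxy he
      rw [faceEdge_comm, faceEdge_oppFace] at hxy
      apply hab
      -- `{a, b} = {x, y}` gives `s(a, b) = s(x, y)`
      have hne : faceVertex w (r + 1) ≠ faceVertex w (r + 2) := fun e =>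
        absurd (add_left_cancel (faceVertex_injective w e)) (by decide)
      have ha : faceVertex w (r + 1) ∈ ({x, y} : Finset (Site 2)) := by rw [← hxy]; simp
      have hb : faceVertex w (r + 2) ∈ ({x, y} : Finset (Site 2)) := by rw [← hxy]; simp
      simp only [Finset.mem_insert, Finset.mem_singleton] at ha hb
      rcases ha with ha | ha <;> rcases hb with hb | hb
      · exact absurd (ha.trans hb.symm) hne
      · rw [ha, hb]; exact he
      · rw [ha, hb, Sym2.eq_swap]; exact he
      · exact absurd (ha.trans hb.symm) hne
  unfold Separates at hns
  push Not at hns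
  obtain ⟨F, hF, hreach⟩ := hns
  exact hsep F hF (Relation.ReflTransGen.head hstep hreach)

/-- The darts of the path are darts of the chord loop. [folklore] -/
theorem mem_cycDarts_chordLoop_of_mem_pathDarts (hQne : Q ≠ []) (len : ℕ) {d : Site 2 × Site 2} (hd : d ∈ pathDarts Q) :
    d ∈ cycDarts (D.chordLoop Q nv len) := by
  rw [D.cycDarts_chordLoop hQne]
  exact List.mem_append_left _ hd

/-- **The face `w` lies to the left of the chord loop, the path traverses `x₁ → x₂`, and `z` lies
to the right** ("we trace the edge `x₁x₂` from `x₂` to `x₁`", p. 177, in the source's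
orientation): `w` is joined off the path to a face of `A₀` (the path does not separate it),
and those lie to the left (`faceLabel_eq_leftLabel_of_stretch_zero`); the face left of
`x₁ → x₂` is `w`, so the loop cannot traverse `x₂ → x₁`; and `z` is the face right of `x₁ → x₂`. [cite: BollobasRiordan2006, Ch. 7 §7.2.2 p. 177] -/
theorem faceLabel_chordLoop_w (hQne : Q ≠ []) (hQG : ∀ s ∈ Q, s ∈ D.verts)
    (hnu1 : D.pos 1 ≤ nu) (hnu2 : nu < D.pos 2) (hnv2 : D.pos 2 ≤ nv) (hnvL : nv < #(triBdryDarts D.verts))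
    (hC : IsTriLoop (D.chordLoop Q nv (nu + #(triBdryDarts D.verts) - nv)))
    (hab : s(faceVertex w (r + 1), faceVertex w (r + 2)) ∈ {e : Sym2 (Site 2) | ∃ d ∈ pathDarts Q, e = s(d.1, d.2)})
    (hns : ¬ Separates D.verts {e : Sym2 (Site 2) | ∃ d ∈ pathDarts Q, e = s(d.1, d.2)} w (D.stretch 0)) :
    faceLabel (cycDarts (D.chordLoop Q nv (nu + #(triBdryDarts D.verts) - nv))) w =
        leftLabel (D.chordLoop Q nv (nu + #(triBdryDarts D.verts) - nv)) ∧
      (faceVertex w (r + 1), faceVertex w (r + 2)) ∈ pathDarts Q ∧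
      faceLabel (cycDarts (D.chordLoop Q nv (nu + #(triBdryDarts D.verts) - nv))) (oppFace w r) =
        leftLabel (D.chordLoop Q nv (nu + #(triBdryDarts D.verts) - nv)) + 1 := by
  set L := #(triBdryDarts D.verts) with hL
  set C := D.chordLoop Q nv (nu + L - nv) with hCdef
  have hlen : nv + (nu + L - nv) = nu + L := by omega
  -- `w` is joined off the path to a face of `A₀`
  have hw : faceLabel (cycDarts C) w = leftLabel C := by
    unfold Separates at hns
    push Not at hns
    obtain ⟨F, hF, hreach⟩ := hns
    rw [D.faceLabel_chordLoop_eq_of_reflTransGen hQne hC hreach]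
    exact D.faceLabel_eq_leftLabel_of_stretch_zero hQne hQG hnu1 hnu2 hnv2 hnvL hlen hC hF
  -- orientation
  have e12 : r + 1 + 1 = r + 2 := by rw [add_assoc]; rfl
  have hwl : leftFace (faceVertex w (r + 1)) (faceVertex w (r + 2)) = w := by
    rw [← e12]; exact leftFace_faceVertex w (r + 1)
  obtain ⟨d, hd, he⟩ := hab
  have hdart : (faceVertex w (r + 1), faceVertex w (r + 2)) ∈ pathDarts Q := by
    rcases Sym2.eq_iff.1 he with ⟨h1, h2⟩ | ⟨h1, h2⟩
    · rw [h1, h2]; exact hd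
    · -- the reversed dart would put `w` on the right
      exfalso
      have hdC := D.mem_cycDarts_chordLoop_of_mem_pathDarts (nv := nv) hQne (nu + L - nv) hd
      have := hC.faceLabel_rightFace hdC
      rw [← h1, ← h2, hwl, hw] at this
      have key : ∀ a : ZMod 2, a ≠ a + 1 := by decide
      exact key _ this
  refine ⟨hw, hdart, ?_⟩
  have hdC := D.mem_cycDarts_chordLoop_of_mem_pathDarts (nv := nv) hQne (nu + L - nv) hdart
  have := hC.faceLabel_rightFace hdC
  simp only at this
  rwa [leftFace_faceVertex_rev] at this

/-- The bonds of the path `Q = L₁ ++ S ++ L₂` through a nonempty segment `S`: those up to the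
start of `S`, those of `S`, those from the end of `S`. [folklore] -/
theorem exists_mem_pathDarts_three_iff {L₁ S L₂ : List (Site 2)} (hS : S ≠ []) {e : Sym2 (Site 2)} :
    (∃ d ∈ pathDarts (L₁ ++ S ++ L₂), e = s(d.1, d.2)) ↔
      (∃ d ∈ pathDarts (L₁ ++ [S.head hS]), e = s(d.1, d.2)) ∨ (∃ d ∈ pathDarts S, e = s(d.1, d.2)) ∨
        (∃ d ∈ pathDarts (S.getLast hS :: L₂), e = s(d.1, d.2)) := by
  -- split at the two junctions
  have key1 : ∀ {A B : List (Site 2)} (hB : B ≠ []), (∃ d ∈ pathDarts (A ++ B), e = s(d.1, d.2)) ↔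
      (∃ d ∈ pathDarts (A ++ [B.head hB]), e = s(d.1, d.2)) ∨ (∃ d ∈ pathDarts B, e = s(d.1, d.2)) := by
    intro A B hB
    by_cases hA : A = []
    · subst hA; simp
    · rw [exists_mem_pathDarts_append_iff hA hB, exists_mem_pathDarts_append_iff hA (List.cons_ne_nil _ _)]
      simp only [List.head_cons, pathDarts_singleton, List.not_mem_nil, false_and, exists_false, false_or]
      constructor
      · rintro (h | h | h)
        · exact Or.inl (Or.inl h)
        · exact Or.inr h
        · exact Or.inl (Or.inr h)
      · rintro ((h | h) | h)
        · exact Or.inl h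
        · exact Or.inr (Or.inr h)
        · exact Or.inr (Or.inl h)
  have key2 : ∀ {A B : List (Site 2)} (hA : A ≠ []), (∃ d ∈ pathDarts (A ++ B), e = s(d.1, d.2)) ↔
      (∃ d ∈ pathDarts A, e = s(d.1, d.2)) ∨ (∃ d ∈ pathDarts (A.getLast hA :: B), e = s(d.1, d.2)) := by
    intro A B hA
    by_cases hB : B = []
    · subst hB; simp
    · rw [exists_mem_pathDarts_append_iff hA hB,
        show A.getLast hA :: B = [A.getLast hA] ++ B from rfl,
        exists_mem_pathDarts_append_iff (List.cons_ne_nil _ _) hB]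
      simp only [List.getLast_singleton, pathDarts_singleton, List.not_mem_nil, false_and, exists_false,
        false_or]
  rw [key2 (show L₁ ++ S ≠ [] by simp [hS]), key1 hS, List.getLast_append_of_right_ne_nil _ _ hS, or_assoc]

/-- **The shortcut lemma.** Let the path `Q = L₁ ++ S ++ L₂` be modified on the segment `S`
(from `p` to `q`) into an admissible path `Q° = L₁ ++ (p :: R ++ [q]) ++ L₂`, and let
`Θ = S ++ R.reverse` — the segment closed up backwards along the new piece — be a lattice loop
of sites of `G`. Then, as `Q°` does not separate `w` from `A₀`, the face `w` lies outside `Θ`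
(label `0`): along a dual path from `w` to a face of `A₀` not crossing `Q°`, the labels with
respect to the chord loop of `Q` and to `Θ` change together (both exactly at the bonds of `S`),
the former is `leftLabel` at both ends, and the latter is `0` at the far end. [folklore] -/
theorem faceLabel_loop_eq_zero_of_shortcut (hQne : Q ≠ []) (hQG : ∀ s ∈ Q, s ∈ D.verts)
    (hnu1 : D.pos 1 ≤ nu) (hnu2 : nu < D.pos 2) (hnv2 : D.pos 2 ≤ nv) (hnvL : nv < #(triBdryDarts D.verts))
    (hC : IsTriLoop (D.chordLoop Q nv (nu + #(triBdryDarts D.verts) - nv)))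
    (hπw : faceLabel (cycDarts (D.chordLoop Q nv (nu + #(triBdryDarts D.verts) - nv))) w =
      leftLabel (D.chordLoop Q nv (nu + #(triBdryDarts D.verts) - nv)))
    (hnotw : ∀ Q' : List (Site 2), (hne : Q' ≠ []) → Q'.Nodup → List.IsChain triGraph.Adj Q' →
      (∀ s ∈ Q', s ∈ D.verts ∧ s ∈ ω) → Q'.head hne ∈ D.arc 1 → Q'.getLast hne ∈ D.arc 2 →
      ¬ Separates D.verts {e : Sym2 (Site 2) | ∃ d ∈ pathDarts Q', e = s(d.1, d.2)} w (D.stretch 0))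
    {L₁ S R L₂ : List (Site 2)} (hS : S ≠ []) (hQeq : Q = L₁ ++ S ++ L₂)
    (hQ'nd : (L₁ ++ (S.head hS :: R ++ [S.getLast hS]) ++ L₂).Nodup)
    (hQ'ch : List.IsChain triGraph.Adj (L₁ ++ (S.head hS :: R ++ [S.getLast hS]) ++ L₂))
    (hQ'G : ∀ s ∈ L₁ ++ (S.head hS :: R ++ [S.getLast hS]) ++ L₂, s ∈ D.verts ∧ s ∈ ω)
    (hQ'head : (L₁ ++ (S.head hS :: R ++ [S.getLast hS]) ++ L₂).head (by simp) ∈ D.arc 1)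
    (hQ'last : (L₁ ++ (S.head hS :: R ++ [S.getLast hS]) ++ L₂).getLast (by simp) ∈ D.arc 2)
    (hΘ : IsTriLoop (S ++ R.reverse)) (hΘG : ∀ s ∈ S ++ R.reverse, s ∈ D.verts) :
    faceLabel (cycDarts (S ++ R.reverse)) w = 0 := by
  set L := #(triBdryDarts D.verts) with hL
  set C := D.chordLoop Q nv (nu + L - nv) with hCdef
  set p := S.head hS with hp
  set q := S.getLast hS with hq
  set Q' := L₁ ++ (p :: R ++ [q]) ++ L₂ with hQ'
  have hlen : nv + (nu + L - nv) = nu + L := by omega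
  -- a dual path from `w` to `A₀` not crossing `Q'`
  have hns := hnotw Q' (by simp [hQ']) hQ'nd hQ'ch hQ'G hQ'head hQ'last
  unfold Separates at hns
  push Not at hns
  obtain ⟨F, hF, hreach⟩ := hns
  -- the two loops have the same allowed bonds
  have hΘdarts : ∀ d ∈ cycDarts (S ++ R.reverse), d.1 ∈ D.verts ∧ d.2 ∈ D.verts := fun d hd =>
    ⟨hΘG _ (mem_of_mem_cycDarts hd).1, hΘG _ (mem_of_mem_cycDarts hd).2⟩
  have hpar : ∀ x y, x ∈ D.verts → y ∈ D.verts →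
      s(x, y) ∉ {e : Sym2 (Site 2) | ∃ d ∈ pathDarts Q', e = s(d.1, d.2)} →
      lbond (cycDarts C) x y = lbond (cycDarts (S ++ R.reverse)) x y := by
    intro x y hx hy hnot
    rw [hC.lbond_eq_ite, hΘ.lbond_eq_ite]
    have hnot' : ¬ ∃ d ∈ pathDarts Q', s(x, y) = s(d.1, d.2) := hnot
    have hRne : p :: R ++ [q] ≠ [] := by simp
    rw [hQ', exists_mem_pathDarts_three_iff hRne] at hnot'
    simp only [not_or] at hnot'
    obtain ⟨hn1, hn2, hn3⟩ := hnot'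
    have hheadR : (p :: R ++ [q]).head hRne = p := by simp
    have hlastR : (p :: R ++ [q]).getLast hRne = q := by simp
    rw [hheadR] at hn1
    rw [hlastR] at hn3
    -- bonds of `C` inside `G` = bonds of `Q`; allowed ones are bonds of `S`
    have hCiff : (∃ d ∈ cycDarts C, s(x, y) = s(d.1, d.2)) ↔ ∃ d ∈ pathDarts S, s(x, y) = s(d.1, d.2) := by
      constructor
      · rintro ⟨d, hd, he⟩
        have h12 : d.1 ∈ D.verts ∧ d.2 ∈ D.verts := by
          have h1 : d.1 ∈ s(x, y) := by rw [he]; exact Sym2.mem_mk_left _ _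
          have h2 : d.2 ∈ s(x, y) := by rw [he]; exact Sym2.mem_mk_right _ _
          constructor
          · rcases Sym2.mem_iff.1 h1 with h | h <;> (rw [h]; assumption)
          · rcases Sym2.mem_iff.1 h2 with h | h <;> (rw [h]; assumption)
        have hdQ := D.mem_pathDarts_of_mem_cycDarts_chordLoop hQne hd h12.1 h12.2
        have : ∃ d ∈ pathDarts Q, s(x, y) = s(d.1, d.2) := ⟨d, hdQ, he⟩
        rw [hQeq, exists_mem_pathDarts_three_iff hS] at this
        rcases this with h | h | h
        · exact absurd h hn1
        · exact h
        · exact absurd h hn3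
      · rintro ⟨d, hd, he⟩
        have : ∃ d' ∈ pathDarts (L₁ ++ S ++ L₂), s(d.1, d.2) = s(d'.1, d'.2) := by
          rw [exists_mem_pathDarts_three_iff hS]; exact Or.inr (Or.inl ⟨d, hd, rfl⟩)
        obtain ⟨d', hd', he'⟩ := this
        rw [← hQeq] at hd'
        exact ⟨d', D.mem_cycDarts_chordLoop_of_mem_pathDarts (nv := nv) hQne (nu + L - nv) hd', he.trans he'⟩
    -- bonds of `Θ` = bonds of `S` and of the new piece; allowed ones are bonds of `S`
    have hΘiff : (∃ d ∈ cycDarts (S ++ R.reverse), s(x, y) = s(d.1, d.2)) ↔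
        ∃ d ∈ pathDarts S, s(x, y) = s(d.1, d.2) := by
      have hSeq : S = p :: S.tail := (List.cons_head_tail hS).symm
      have hcyc : cycDarts (S ++ R.reverse) = pathDarts ([] ++ S ++ (p :: R).reverse) := by
        rw [List.nil_append, List.reverse_cons, ← List.append_assoc]
        conv_lhs => rw [hSeq, List.cons_append]
        show pathDarts (p :: (S.tail ++ R.reverse) ++ [p]) = _
        rw [← List.cons_append, ← hSeq]
      rw [hcyc, exists_mem_pathDarts_three_iff hS]
      simp only [List.nil_append, pathDarts_singleton, List.not_mem_nil, false_and, exists_false, false_or]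
      have hrev : q :: (p :: R).reverse = (p :: R ++ [q]).reverse := by simp
      rw [show S.getLast hS = q from rfl, hrev, exists_mem_pathDarts_reverse_iff]
      constructor
      · rintro (h | h)
        · exact h
        · exact absurd h hn2
      · exact fun h => Or.inl h
    simp only [hCiff, hΘiff]
  -- compare the two labels along the dual path
  have hsum := faceLabel_add_eq_of_reflTransGen_dualStep hC.adj hΘ.adj hpar hreach
  have hπF : faceLabel (cycDarts C) F = leftLabel C :=
    D.faceLabel_eq_leftLabel_of_stretch_zero hQne hQG hnu1 hnu2 hnv2 hnvL hlen hC hF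
  have hθF : faceLabel (cycDarts (S ++ R.reverse)) F = 0 := by
    obtain ⟨d, hd, -, hd2⟩ := hF
    obtain ⟨p', -, rfl⟩ := D.mem_stretch_zero_iff3.1 hd
    exact D.faceLabel_eq_zero_of_bdryHead_mem hΘ.adj hΘdarts (n := p') hd2
  rw [hπw, hπF, hθF] at hsum
  have key : ∀ a b : ZMod 2, a + b = a + 0 → b = 0 := by decide
  exact key _ _ hsum

/-- **`x₃` is closed** ("otherwise, the open path `P₁x₃P₂` separates `w` from `A₃⁺`",
p. 177): if `x₃` is off the path and open, replace the bond `x₁x₂` of the path by `x₁x₃x₂`; the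
triangle `x₁x₂x₃` closes the bond up, `w` has label `1` with respect to it, not `0`
(`faceLabel_loop_eq_zero_of_shortcut`). [cite: BollobasRiordan2006, Ch. 7 Claim 10 p. 177] -/
theorem faceVertex_not_mem_of_not_mem (hQne : Q ≠ []) (hQnd : Q.Nodup) (hQch : List.IsChain triGraph.Adj Q)
    (hQG : ∀ s ∈ Q, s ∈ D.verts) (hQω : ∀ s ∈ Q, s ∈ ω)
    (hQhead : Q.head hQne ∈ D.arc 1) (hQlast : Q.getLast hQne ∈ D.arc 2)
    (hnu1 : D.pos 1 ≤ nu) (hnu2 : nu < D.pos 2) (hnv2 : D.pos 2 ≤ nv) (hnvL : nv < #(triBdryDarts D.verts))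
    (hC : IsTriLoop (D.chordLoop Q nv (nu + #(triBdryDarts D.verts) - nv)))
    (hπw : faceLabel (cycDarts (D.chordLoop Q nv (nu + #(triBdryDarts D.verts) - nv))) w =
      leftLabel (D.chordLoop Q nv (nu + #(triBdryDarts D.verts) - nv)))
    (hnotw : ∀ Q' : List (Site 2), (hne : Q' ≠ []) → Q'.Nodup → List.IsChain triGraph.Adj Q' →
      (∀ s ∈ Q', s ∈ D.verts ∧ s ∈ ω) → Q'.head hne ∈ D.arc 1 → Q'.getLast hne ∈ D.arc 2 →
      ¬ Separates D.verts {e : Sym2 (Site 2) | ∃ d ∈ pathDarts Q', e = s(d.1, d.2)} w (D.stretch 0))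
    (hw : hexFaceVertices w ⊆ D.verts)
    (hdart : (faceVertex w (r + 1), faceVertex w (r + 2)) ∈ pathDarts Q) (hxQ : faceVertex w r ∉ Q) :
    faceVertex w r ∉ ω := by
  intro hxω
  set x := faceVertex w r with hx
  set a := faceVertex w (r + 1) with ha
  set b := faceVertex w (r + 2) with hb
  have hinj := faceVertex_injective w
  have hxa : x ≠ a := fun e => absurd (add_eq_left.1 (hinj e).symm) (by decide)
  have hxb : x ≠ b := fun e => absurd (add_eq_left.1 (hinj e).symm) (by decide)
  have hab : a ≠ b := fun e => absurd (add_left_cancel (hinj e)) (by decide)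
  have e2 : r + 1 + 1 = r + 2 := by rw [add_assoc]; rfl
  have e3 : r + 2 + 1 = r := by rw [add_assoc]; exact add_eq_left.2 (by decide)
  have e4 : r + 1 + 2 = r := by rw [add_assoc]; exact add_eq_left.2 (by decide)
  have hadj_ax : triGraph.Adj a x := by
    have := TriMarkedDomain.adj_faceVertex_succ w (r + 2)
    rw [e3] at this
    have h' := TriMarkedDomain.adj_faceVertex_succ w r
    exact h'.symm
  have hadj_xb : triGraph.Adj x b := by
    have := TriMarkedDomain.adj_faceVertex_succ w (r + 2); rw [e3] at this; exact this.symm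
  obtain ⟨L₁, L₂, hQeq⟩ := exists_append_of_mem_pathDarts hdart
  have hQeq' : Q = L₁ ++ [a, b] ++ L₂ := by rw [hQeq, List.append_assoc]; rfl
  have hS : ([a, b] : List (Site 2)) ≠ [] := List.cons_ne_nil _ _
  have key := D.faceLabel_loop_eq_zero_of_shortcut hQne hQG hnu1 hnu2 hnv2 hnvL hC hπw hnotw
    (L₁ := L₁) (S := [a, b]) (R := [x]) (L₂ := L₂) hS hQeq' ?_ ?_ ?_ ?_ ?_ ?_ ?_
  · -- the triangle has label `1` at `w`
    have h1 := faceLabel_triangle_self' w (r + 1)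
    rw [e2, e4] at h1
    change faceLabel (cycDarts [a, b, x]) w = 0 at key
    rw [key] at h1
    exact absurd h1 (by decide)
  · -- duplicate-free
    refine nodup_append3_of_nodup (hQeq' ▸ hQnd) ?_ ?_
    · simp [hxa.symm, hab, hxb]
    · intro s hs
      have hs' : s = a ∨ s = x ∨ s = b := by simpa using hs
      rcases hs' with h | h | h
      · exact Or.inl (by rw [h]; simp)
      · exact Or.inr (by rw [h, ← hQeq']; exact hxQ)
      · exact Or.inl (by rw [h]; simp)
  · -- a chain
    refine isChain_append3_of_isChain hS (by simp) (hQeq' ▸ hQch) ?_ (by rfl) (by rfl)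
    simp [hadj_ax, hadj_xb]
  · -- sites of `G`, open: every site is on `Q` or is `x`
    intro s hs
    have hs' : s ∈ Q ∨ s = x := by
      have hmem : s ∈ L₁ ∨ s = a ∨ s = x ∨ s = b ∨ s ∈ L₂ := by simpa [or_assoc] using hs
      rw [hQeq']
      rcases hmem with h | h | h | h | h
      · exact Or.inl (by simp [h])
      · exact Or.inl (by simp [h])
      · exact Or.inr h
      · exact Or.inl (by simp [h])
      · exact Or.inl (by simp [h])
    rcases hs' with h | h
    · exact ⟨hQG _ h, hQω _ h⟩
    · rw [h]; exact ⟨hw (faceVertex_mem _ _), hxω⟩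
  · rw [head_append3_eq hS (by simp) (by rfl)]
    convert hQhead using 2; exact hQeq'.symm
  · rw [getLast_append3_eq hS (by simp) (by rfl)]
    convert hQlast using 2; exact hQeq'.symm
  · -- the triangle is a loop
    have := isTriLoop_faceVertex' w (r + 1)
    rwa [e2, e4] at this
  · intro s hs
    simp only [List.reverse_singleton, List.cons_append, List.nil_append, List.mem_cons, List.not_mem_nil,
      or_false] at hs
    rcases hs with rfl | rfl | rfl <;> exact hw (faceVertex_mem _ _)

/-- Labels only see the bonds: three darts spanning the sides of a face give the label `1` at
the face, whatever their order and orientations. [folklore] -/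
theorem faceLabel_three_darts_eq_one (w : HexVertex) (j : Fin 3) {d₁ d₂ d₃ : Site 2 × Site 2}
    (h₁ : s(d₁.1, d₁.2) = s(faceVertex w j, faceVertex w (j + 1)))
    (h₂ : s(d₂.1, d₂.2) = s(faceVertex w (j + 1), faceVertex w (j + 2)))
    (h₃ : s(d₃.1, d₃.2) = s(faceVertex w (j + 2), faceVertex w j)) :
    faceLabel [d₁, d₂, d₃] w = 1 := by
  rw [← faceLabel_triangle_self' w j, cycDarts_triple]
  -- normalise each dart to the anticlockwise orientation
  have n1 : faceLabel [d₁, d₂, d₃] w = faceLabel [(faceVertex w j, faceVertex w (j + 1)), d₂, d₃] w := by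
    rcases Sym2.eq_iff.1 h₁ with ⟨e1, e2⟩ | ⟨e1, e2⟩
    · rw [← e1, ← e2]
    · rw [← e1, ← e2, ← faceLabel_cons_swap]
  have n2 : ∀ D₀ : Site 2 × Site 2, faceLabel [D₀, d₂, d₃] w =
      faceLabel [D₀, (faceVertex w (j + 1), faceVertex w (j + 2)), d₃] w := by
    intro D₀
    have hp : [D₀, d₂, d₃].Perm [d₂, D₀, d₃] := List.Perm.swap _ _ _
    have hp' : [D₀, (faceVertex w (j + 1), faceVertex w (j + 2)), d₃].Perm
        [(faceVertex w (j + 1), faceVertex w (j + 2)), D₀, d₃] := List.Perm.swap _ _ _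
    rw [faceLabel_perm hp, faceLabel_perm hp']
    rcases Sym2.eq_iff.1 h₂ with ⟨e1, e2⟩ | ⟨e1, e2⟩
    · rw [← e1, ← e2]
    · rw [← e1, ← e2, ← faceLabel_cons_swap]
  have n3 : ∀ D₀ D₁ : Site 2 × Site 2, faceLabel [D₀, D₁, d₃] w =
      faceLabel [D₀, D₁, (faceVertex w (j + 2), faceVertex w j)] w := by
    intro D₀ D₁
    have hp : [D₀, D₁, d₃].Perm ([d₃] ++ [D₀, D₁]) := List.perm_append_comm (l₁ := [D₀, D₁]) (l₂ := [d₃])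
    have hp' : [D₀, D₁, (faceVertex w (j + 2), faceVertex w j)].Perm
        ([(faceVertex w (j + 2), faceVertex w j)] ++ [D₀, D₁]) :=
      List.perm_append_comm (l₁ := [D₀, D₁]) (l₂ := [(faceVertex w (j + 2), faceVertex w j)])
    rw [faceLabel_perm hp, faceLabel_perm hp']
    show faceLabel [d₃, D₀, D₁] w = faceLabel [(faceVertex w (j + 2), faceVertex w j), D₀, D₁] w
    rcases Sym2.eq_iff.1 h₃ with ⟨e1, e2⟩ | ⟨e1, e2⟩
    · rw [← e1, ← e2]
    · rw [← e1, ← e2, ← faceLabel_cons_swap]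
  rw [n1, n2, n3]

/-- **`x₃` is not on the path.** If it were, say before `x₁` — the path running
`… x₃ ⋯ x₁ x₂ …` — then shortcutting from `x₃` straight to `x₂`, resp. straight to `x₁`, gives
admissible paths; the skipped pieces close up to loops with `w` outside both
(`faceLabel_loop_eq_zero_of_shortcut`), whose darts together with the skipped ones counted
twice are the three sides of `w` — giving `w` the label `0 + 0 ≠ 1`. Symmetrically after `x₂`. [folklore] -/
theorem faceVertex_not_mem_support (hQne : Q ≠ []) (hQnd : Q.Nodup) (hQch : List.IsChain triGraph.Adj Q)
    (hQG : ∀ s ∈ Q, s ∈ D.verts) (hQω : ∀ s ∈ Q, s ∈ ω)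
    (hQhead : Q.head hQne ∈ D.arc 1) (hQlast : Q.getLast hQne ∈ D.arc 2)
    (hnu1 : D.pos 1 ≤ nu) (hnu2 : nu < D.pos 2) (hnv2 : D.pos 2 ≤ nv) (hnvL : nv < #(triBdryDarts D.verts))
    (hC : IsTriLoop (D.chordLoop Q nv (nu + #(triBdryDarts D.verts) - nv)))
    (hπw : faceLabel (cycDarts (D.chordLoop Q nv (nu + #(triBdryDarts D.verts) - nv))) w =
      leftLabel (D.chordLoop Q nv (nu + #(triBdryDarts D.verts) - nv)))
    (hnotw : ∀ Q' : List (Site 2), (hne : Q' ≠ []) → Q'.Nodup → List.IsChain triGraph.Adj Q' →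
      (∀ s ∈ Q', s ∈ D.verts ∧ s ∈ ω) → Q'.head hne ∈ D.arc 1 → Q'.getLast hne ∈ D.arc 2 →
      ¬ Separates D.verts {e : Sym2 (Site 2) | ∃ d ∈ pathDarts Q', e = s(d.1, d.2)} w (D.stretch 0))
    (hw : hexFaceVertices w ⊆ D.verts)
    (hdart : (faceVertex w (r + 1), faceVertex w (r + 2)) ∈ pathDarts Q) : faceVertex w r ∉ Q := by
  intro hxQ
  set x := faceVertex w r with hx
  set a := faceVertex w (r + 1) with ha
  set b := faceVertex w (r + 2) with hb
  have hinj := faceVertex_injective w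
  have hxa : x ≠ a := fun e => absurd (add_eq_left.1 (hinj e).symm) (by decide)
  have hxb : x ≠ b := fun e => absurd (add_eq_left.1 (hinj e).symm) (by decide)
  have hab : a ≠ b := fun e => absurd (add_left_cancel (hinj e)) (by decide)
  have e2 : r + 1 + 1 = r + 2 := by rw [add_assoc]; rfl
  have e3 : r + 2 + 1 = r := by rw [add_assoc]; exact add_eq_left.2 (by decide)
  have e4 : r + 1 + 2 = r := by rw [add_assoc]; exact add_eq_left.2 (by decide)
  have hadj_xa : triGraph.Adj x a := TriMarkedDomain.adj_faceVertex_succ w r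
  have hadj_ab : triGraph.Adj a b := by rw [hb, ← e2]; exact TriMarkedDomain.adj_faceVertex_succ w (r + 1)
  have hadj_bx : triGraph.Adj b x := by
    have := TriMarkedDomain.adj_faceVertex_succ w (r + 2); rwa [e3] at this
  have hwG : ∀ s, s = x ∨ s = a ∨ s = b → s ∈ D.verts := by
    rintro s (rfl | rfl | rfl) <;> exact hw (faceVertex_mem _ _)
  -- the common shape of the argument: a segment `S` of `Q` from `p` to `q` with `p ~ q`,
  -- shortcut by the bond `pq`, is a loop with `w` outside
  have shortcut : ∀ {L₁ S L₂ : List (Site 2)} (hS : S ≠ []), Q = L₁ ++ S ++ L₂ →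
      triGraph.Adj (S.getLast hS) (S.head hS) → 3 ≤ S.length → faceLabel (cycDarts S) w = 0 := by
    intro L₁ S L₂ hS hQeq hpq h3
    have hSnd : S.Nodup := by
      have := hQeq ▸ hQnd
      exact ((List.nodup_append.1 this).1 |> fun h => (List.nodup_append.1 h).2.1)
    have hSch : List.IsChain triGraph.Adj S := isChain_of_append3 (hQeq ▸ hQch)
    have hSG : ∀ s ∈ S, s ∈ D.verts := fun s hs => hQG s (by rw [hQeq]; simp [hs])
    have hΘ : IsTriLoop (S ++ ([] : List (Site 2)).reverse) := by
      rw [List.reverse_nil, List.append_nil]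
      exact ⟨hSnd, h3, adj_cycDarts_of_isChain hS hSch hpq⟩
    have key := D.faceLabel_loop_eq_zero_of_shortcut hQne hQG hnu1 hnu2 hnv2 hnvL hC hπw hnotw
      (L₁ := L₁) (S := S) (R := []) (L₂ := L₂) hS hQeq ?_ ?_ ?_ ?_ ?_ hΘ ?_
    · rwa [List.reverse_nil, List.append_nil] at key
    · refine nodup_append3_of_nodup (hQeq ▸ hQnd) ?_ fun s hs => Or.inl ?_
      · have hne : S.head hS ≠ S.getLast hS := by
          rw [List.head_eq_getElem_zero hS, List.getLast_eq_getElem]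
          intro e
          have := (hSnd.getElem_inj_iff).1 e
          omega
        simp [hne]
      · have hs' : s = S.head hS ∨ s = S.getLast hS := by simpa using hs
        rcases hs' with rfl | rfl
        · exact List.head_mem hS
        · exact List.getLast_mem hS
    · exact isChain_append3_of_isChain hS (by simp) (hQeq ▸ hQch) (by simpa using hpq.symm) (by simp) (by simp)
    · intro s hs
      have : s ∈ Q := by
        have hs' : s ∈ L₁ ∨ s = S.head hS ∨ s = S.getLast hS ∨ s ∈ L₂ := by simpa [or_assoc] using hs
        rw [hQeq]
        rcases hs' with h | h | h | h
        · simp [h]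
        · rw [h]; simp [List.head_mem hS]
        · rw [h]; simp [List.getLast_mem hS]
        · simp [h]
      exact ⟨hQG s this, hQω s this⟩
    · rw [head_append3_eq hS (by simp) (by simp)]; convert hQhead using 2; exact hQeq.symm
    · rw [getLast_append3_eq hS (by simp) (by simp)]; convert hQlast using 2; exact hQeq.symm
    · rw [List.reverse_nil, List.append_nil]; exact hSG
  have zkey : ∀ A B C : ZMod 2, A + B = 0 → A + C = 0 → B + C = 0 := by decide
  have h1ne : (1 : ZMod 2) ≠ 0 := by decide
  -- where is `x` on the path: before `a` or after `b`
  obtain ⟨L₁, L₂, hQeq⟩ := exists_append_of_mem_pathDarts hdart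
  have hx12 : x ∈ L₁ ∨ x ∈ L₂ := by
    have : x ∈ L₁ ++ a :: b :: L₂ := hQeq ▸ hxQ
    simp only [List.mem_append, List.mem_cons] at this
    rcases this with h | h | h | h
    · exact Or.inl h
    · exact absurd h hxa
    · exact absurd h hxb
    · exact Or.inr h
  rcases hx12 with hx1 | hx2
  · -- `Q = L₀ ++ x :: M ++ a :: b :: L₂`
    obtain ⟨L₀, M, hL₁⟩ := List.append_of_mem hx1
    have hQ1 : Q = L₀ ++ (x :: (M ++ [a, b])) ++ L₂ := by rw [hQeq, hL₁]; simp
    have θ₁ := shortcut (S := x :: (M ++ [a, b])) (List.cons_ne_nil _ _) hQ1 (by simpa using hadj_bx)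
      (by simp)
    by_cases hM : M = []
    · subst hM
      have h1 := faceLabel_triangle_self' w r
      change faceLabel (cycDarts [x, a, b]) w = 1 at h1
      simp only [List.nil_append] at θ₁
      rw [θ₁] at h1
      exact h1ne h1.symm
    · have hQ2 : Q = L₀ ++ (x :: (M ++ [a])) ++ (b :: L₂) := by rw [hQeq, hL₁]; simp
      have θ₂ := shortcut (S := x :: (M ++ [a])) (List.cons_ne_nil _ _) hQ2 (by simpa using hadj_xa.symm)
        (by simp; have := List.length_pos_iff.2 hM; omega)
      -- the darts: `Θ₁ = P₀ ++ [ab, bx]`, `Θ₂ = P₀ ++ [ax]`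
      have hne0 : x :: (M ++ [a]) ≠ [] := List.cons_ne_nil _ _
      have hlast0 : (x :: (M ++ [a])).getLast hne0 = a := by simp
      have hc1 : cycDarts (x :: (M ++ [a, b])) = pathDarts (x :: (M ++ [a])) ++ [(a, b), (b, x)] := by
        show pathDarts (x :: (M ++ [a, b]) ++ [x]) = _
        rw [show x :: (M ++ [a, b]) ++ [x] = (x :: (M ++ [a])) ++ [b, x] by simp,
          pathDarts_append hne0 (by simp), hlast0]
        rfl
      have hc2 : cycDarts (x :: (M ++ [a])) = pathDarts (x :: (M ++ [a])) ++ [(a, x)] := by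
        show pathDarts (x :: (M ++ [a]) ++ [x]) = _
        rw [pathDarts_append_singleton hne0, hlast0]
      rw [hc1, faceLabel_append] at θ₁
      rw [hc2, faceLabel_append] at θ₂
      have h3 := zkey _ _ _ θ₁ θ₂
      rw [← faceLabel_append] at h3
      have h1 := faceLabel_three_darts_eq_one w (r + 1) (d₁ := (a, b)) (d₂ := (b, x)) (d₃ := (a, x))
        (by rw [e2]) (by rw [e2, e4]) (by rw [e4, Sym2.eq_swap])
      exact h1ne (h1.symm.trans h3)
  · -- `Q = L₁ ++ a :: b :: M ++ x :: L₃`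
    obtain ⟨M, L₃, hL₂⟩ := List.append_of_mem hx2
    have hQ1 : Q = L₁ ++ (a :: b :: (M ++ [x])) ++ L₃ := by rw [hQeq, hL₂]; simp
    have θ₁ := shortcut (S := a :: b :: (M ++ [x])) (List.cons_ne_nil _ _) hQ1 (by simpa using hadj_xa)
      (by simp)
    by_cases hM : M = []
    · subst hM
      have h1 := faceLabel_triangle_self' w (r + 1)
      rw [e2, e4] at h1
      change faceLabel (cycDarts [a, b, x]) w = 1 at h1
      simp only [List.nil_append] at θ₁
      rw [θ₁] at h1
      exact h1ne h1.symm
    · have hQ2 : Q = (L₁ ++ [a]) ++ (b :: (M ++ [x])) ++ L₃ := by rw [hQeq, hL₂]; simp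
      have θ₂ := shortcut (S := b :: (M ++ [x])) (List.cons_ne_nil _ _) hQ2 (by simpa using hadj_bx.symm)
        (by simp; have := List.length_pos_iff.2 hM; omega)
      have hne0 : b :: (M ++ [x]) ≠ [] := List.cons_ne_nil _ _
      have hlast0 : (b :: (M ++ [x])).getLast hne0 = x := by simp
      have hc1 : cycDarts (a :: b :: (M ++ [x])) = [(a, b)] ++ (pathDarts (b :: (M ++ [x])) ++ [(x, a)]) := by
        show pathDarts (a :: b :: (M ++ [x]) ++ [a]) = _
        rw [show a :: b :: (M ++ [x]) ++ [a] = a :: (b :: (M ++ [x]) ++ [a]) by simp,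
          show b :: (M ++ [x]) ++ [a] = b :: (M ++ [x] ++ [a]) by simp, pathDarts_cons_cons,
          show b :: (M ++ [x] ++ [a]) = b :: (M ++ [x]) ++ [a] by simp, pathDarts_append_singleton hne0, hlast0]
        rfl
      have hc2 : cycDarts (b :: (M ++ [x])) = pathDarts (b :: (M ++ [x])) ++ [(x, b)] := by
        show pathDarts (b :: (M ++ [x]) ++ [b]) = _
        rw [pathDarts_append_singleton hne0, hlast0]
      rw [hc1, faceLabel_append, faceLabel_append] at θ₁
      rw [hc2, faceLabel_append] at θ₂
      have zkey' : ∀ A P B C : ZMod 2, A + (P + B) = 0 → P + C = 0 → A + (B + C) = 0 := by decide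
      have h3 := zkey' _ _ _ _ θ₁ θ₂
      rw [← faceLabel_append, ← faceLabel_append] at h3
      have h1 := faceLabel_three_darts_eq_one w (r + 1) (d₁ := (a, b)) (d₂ := (x, b)) (d₃ := (x, a))
        (by rw [e2]) (by rw [e2, e4, Sym2.eq_swap]) (by rw [e4])
      have hp : ([(a, b)] ++ ([(x, a)] ++ [(x, b)])).Perm [(a, b), (x, b), (x, a)] :=
        List.Perm.cons _ (List.Perm.swap _ _ _)
      rw [faceLabel_perm hp] at h3
      exact h1ne (h1.symm.trans h3)

end TriMarkedDomain

end Claim10Frame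
end Literature.Probability.Percolation
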